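import Mathlib.Topology.MetricSpace.ProperSpace
import Summits.FinalStateConjecture.FinalStateConjecture.Theorems.BartnikGapSettlingSettledCaptureCrushDefs
import Summits.FinalStateConjecture.FinalStateConjecture.Theorems.BartnikGapSettlingGapExhaustionAffineCovariance
import Summits.FinalStateConjecture.FinalStateConjecture.Theorems.BartnikGapSettlingGapExhaustionCylindersBendInwardOf
import Literature.Geometry.Lorentzian.KerrSchildChartCovariance
import Literature.Geometry.Lorentzian.KerrSchildTimeTranslation
import HarnessLib

/-!
# Crux `SettledCapture` (stmt-FinalStateConjecture-17328), line `null-concave-crush`: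
# stub 3b `stub_boostedCertificateStable` — `C¹`-openness of the Kerr crush certificate (boosted frame)

Route `BartnikGapSettling`; registered stub 3b of the skeleton `Cruxes/SettledCapture/Lines/null_concave_crush.lean`
(lead a1, rev r5), landed as a `Theorems/` module (`--supports stmt-FinalStateConjecture-17328`); vocabulary
(`KerrCrushCertificate`) from `Theorems/BartnikGapSettlingSettledCaptureCrushDefs.lean`.

Given the weighted null-concave crush certificate WITH MARGIN `m > 0` for exact sub-extremal Kerr `(M, a)` on
the shell `{r₋ + δ ≤ r ≤ r₊ − δ}` and a motion `(Λ, c)`, there is `η > 0` such that for every field of components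
`G` and every point `y` whose rest-frame radius lies in the shell, if the `0`- and `1`-jets of `G` at `y` are
`η`-close to those of `G₀ = boostedKerrBilin Λ c M a`, then on `G y`-null `w`, with `f = F ∘ r ∘ poincareInv Λ c`:
`df_y(w) < 0` whenever `G y (w, Λ V) < 0`, and `f(y) · Hess_G f_y(w, w) ≤ ρ · df_y(w)²` (margin-free).

* `bcs_stable` (the pattern of `stub_hessMarginStable`, `Theorems/BartnikGapSettlingGapExhaustionHessMarginStable`):
  STRICT slope/concavity inequalities on the `G₀`-null directions over a compact set survive `η`-perturbation of the
  `1`-jet (homogeneity; continuity of the jet functional where `G₀ x` is invertible; the sign of `G₀ x v (V x) ≠ 0`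
  locks the slope clause; generalised tube lemma);
* `stub_boostedCertificateStable`: the exact certificate transfers to the boosted frame by covariance under the
  affine `P = poincareInv Λ c` (`affineCov_hessAt`, O'Neill 1983, Ch. 3, Prop. 3.59; chain rule); `bcs_stable` on the
  image of the slice `{x⁰ = 0} ∩ shell` under `x ↦ Λ x + c`; all times by stationarity along `y ↦ y + s Λe₀`
  (`boostedKerrBilin_add_smul`, `poincareInv_add_smul`, `Kerr.timeVector_add_smul_basisVector_zero`).

References: B. O'Neill, *Semi-Riemannian geometry*, Academic Press 1983, Ch. 3, Lemma 3.49, Prop. 3.59; Ch. 5,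
Lemma 5.26 [ONeill1983]; M. Dafermos, I. Rodnianski, arXiv:0811.0354, §5.1 [arXiv08110354].
-/

noncomputable section

-- instance search through the nested operator types `E4 →L[ℝ] E4 →L[ℝ] E4 →L[ℝ] ℝ`
set_option maxSynthPendingDepth 3

-- D-0017: single-problem summit, `Summit.<S>.<S>.…` by design (cf. lakefile `weak.linter.dupNamespace`).
set_option linter.dupNamespace false

namespace Summit.FinalStateConjecture.FinalStateConjecture.Theorems.BartnikGapSettling.SettledCapture

open Set Filter Function TopologicalSpace
open scoped Topology
open Literature.Geometry.Lorentzian Literature.Geometry.Lorentzian.MetricCoord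
open Summit.FinalStateConjecture.FinalStateConjecture.Theorems

/-! ### `C¹`-stability of strict slope/concavity inequalities on null directions (abstract) -/

section Stability

/-- Generalised tube lemma: a property of `(z, p)` holding near `(z, 0)` for every `z` in a compact set `K`
holds for all `z ∈ K` and all `‖p‖ ≤ δ`, for some uniform `δ > 0`. [folklore] -/
private theorem bcs_tube {X P : Type*} [TopologicalSpace X] [SeminormedAddCommGroup P] {K : Set X}
    (hK : IsCompact K) {good : X × P → Prop} (h : ∀ z ∈ K, ∀ᶠ q in 𝓝 (z, (0 : P)), good q) :
    ∃ δ : ℝ, 0 < δ ∧ ∀ z ∈ K, ∀ p : P, ‖p‖ ≤ δ → good (z, p) := by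
  -- adapted from Theorems/BartnikGapSettlingGapExhaustionHessMarginStable (`hessMarginStable_tube`)
  have hmem : {q | good q} ∈ (𝓝ˢ K) ×ˢ 𝓝 (0 : P) :=
    hK.mem_nhdsSet_prod_of_forall fun z hz => by rw [← nhds_prod_eq]; exact h z hz
  obtain ⟨A, hA, B, hB, hAB⟩ := Filter.mem_prod_iff.1 hmem
  obtain ⟨ε, hε, hεB⟩ := Metric.mem_nhds_iff.1 hB
  refine ⟨ε / 2, half_pos hε, fun z hz p hp => hAB (mk_mem_prod (subset_of_mem_nhdsSet hA hz) ?_)⟩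
  exact hεB (mem_ball_zero_iff.2 (hp.trans_lt (half_lt_self hε)))

/-- The local step: at `x ∈ U` (`U` open, `G₀ ∈ C¹(U)`, `f ∈ C²(U)`, `G₀ x` invertible, `V` continuous at `x`)
and a direction `v` at which, if `v` is `G₀ x`-null, `G₀ x v (V x) ≠ 0`, `Df_x v < 0` when `G₀ x v (V x) < 0`, and
`f x · Hess f_x(v,v) − ρ (Df_x v)² < 0`, the implication "null for the perturbed form ⇒ (future ⇒ slope `< 0`) ∧
perturbed weighted concavity `< 0`" holds for all nearby points, directions and `1`-jet perturbations. [folklore] -/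
private theorem bcs_eventually {G₀ : E4 → E4 →L[ℝ] E4 →L[ℝ] ℝ} {f : E4 → ℝ} {V : E4 → E4} {U : Set E4}
    {ρ : ℝ} (hU : IsOpen U) (hG₀ : ContDiffOn ℝ 1 G₀ U) (hf : ContDiffOn ℝ 2 f U) {x : E4} (hx : x ∈ U)
    (hi : (G₀ x).IsInvertible) (hV : ContinuousAt V x) (v : E4)
    (hxv : G₀ x v v = 0 → G₀ x v (V x) ≠ 0 ∧ (G₀ x v (V x) < 0 → fderiv ℝ f x v < 0) ∧
      f x * hessAt G₀ f x v v - ρ * fderiv ℝ f x v ^ 2 < 0) :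
    ∀ᶠ p in 𝓝 (((x, v), 0) : (E4 × E4) × ((E4 →L[ℝ] E4 →L[ℝ] ℝ) × (E4 →L[ℝ] E4 →L[ℝ] E4 →L[ℝ] ℝ))),
      (G₀ p.1.1 + p.2.1) p.1.2 p.1.2 = 0 →
        ((G₀ p.1.1 + p.2.1) p.1.2 (V p.1.1) < 0 → fderiv ℝ f p.1.1 p.1.2 < 0) ∧
          f p.1.1 * (fderiv ℝ (fderiv ℝ f) p.1.1 p.1.2 p.1.2 - fderiv ℝ f p.1.1 ((2⁻¹ : ℝ) •
            (G₀ p.1.1 + p.2.1).inverse (koszulOp (fderiv ℝ G₀ p.1.1 + p.2.2) p.1.2 p.1.2))) -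
            ρ * fderiv ℝ f p.1.1 p.1.2 ^ 2 < 0 := by
  -- adapted from Theorems/BartnikGapSettlingGapExhaustionHessMarginStable (`hessMarginStable_eventually`)
  set p₀ : (E4 × E4) × ((E4 →L[ℝ] E4 →L[ℝ] ℝ) × (E4 →L[ℝ] E4 →L[ℝ] E4 →L[ℝ] ℝ)) := ((x, v), 0) with hp₀
  have hxU : U ∈ 𝓝 x := hU.mem_nhds hx
  have hcG : ContinuousAt G₀ x := hG₀.continuousOn.continuousAt hxU
  have hcdG : ContinuousAt (fderiv ℝ G₀) x := (hG₀.continuousOn_fderiv_of_isOpen hU le_rfl).continuousAt hxU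
  have hcf : ContinuousAt f x := hf.continuousOn.continuousAt hxU
  have hcdf : ContinuousAt (fderiv ℝ f) x := (hf.continuousOn_fderiv_of_isOpen hU (by norm_num)).continuousAt hxU
  have hcddf : ContinuousAt (fderiv ℝ (fderiv ℝ f)) x :=
    ((hf.fderiv_of_isOpen hU (m := 1) (by norm_num)).continuousOn_fderiv_of_isOpen hU le_rfl).continuousAt hxU
  have h11 : Continuous fun p : (E4 × E4) × ((E4 →L[ℝ] E4 →L[ℝ] ℝ) × (E4 →L[ℝ] E4 →L[ℝ] E4 →L[ℝ] ℝ)) => p.1.1 :=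
    continuous_fst.comp continuous_fst
  have h12 : Continuous fun p : (E4 × E4) × ((E4 →L[ℝ] E4 →L[ℝ] ℝ) × (E4 →L[ℝ] E4 →L[ℝ] E4 →L[ℝ] ℝ)) => p.1.2 :=
    continuous_snd.comp continuous_fst
  have h21 : Continuous fun p : (E4 × E4) × ((E4 →L[ℝ] E4 →L[ℝ] ℝ) × (E4 →L[ℝ] E4 →L[ℝ] E4 →L[ℝ] ℝ)) => p.2.1 :=
    continuous_fst.comp continuous_snd
  have h22 : Continuous fun p : (E4 × E4) × ((E4 →L[ℝ] E4 →L[ℝ] ℝ) × (E4 →L[ℝ] E4 →L[ℝ] E4 →L[ℝ] ℝ)) => p.2.2 :=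
    continuous_snd.comp continuous_snd
  -- continuity of the pieces of the jet functional at `p₀ = ((x, v), 0)`
  have hA : ContinuousAt (fun p : (E4 × E4) × (_ × _) => G₀ p.1.1 + p.2.1) p₀ :=
    (hcG.comp h11.continuousAt).add h21.continuousAt
  have hB : ContinuousAt (fun p : (E4 × E4) × (_ × _) => fderiv ℝ f p.1.1) p₀ := hcdf.comp h11.continuousAt
  have hC : ContinuousAt (fun p : (E4 × E4) × (_ × _) => fderiv ℝ (fderiv ℝ f) p.1.1 p.1.2 p.1.2) p₀ :=
    ((hcddf.comp h11.continuousAt).clm_apply h12.continuousAt).clm_apply h12.continuousAt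
  have hD : ContinuousAt (fun p : (E4 × E4) × (_ × _) => (G₀ p.1.1 + p.2.1).inverse) p₀ := by
    refine ContinuousAt.comp_of_eq (hi.contDiffAt_map_inverse (n := 0)).continuousAt hA ?_
    simp [hp₀]
  have hE : ContinuousAt (fun p : (E4 × E4) × (_ × _) => koszulOp (fderiv ℝ G₀ p.1.1 + p.2.2) p.1.2 p.1.2) p₀ :=
    ((koszulOp.continuous.continuousAt.comp ((hcdG.comp h11.continuousAt).add h22.continuousAt)).clm_apply
      h12.continuousAt).clm_apply h12.continuousAt
  have hβ : ContinuousAt (fun p : (E4 × E4) × (_ × _) => fderiv ℝ f p.1.1 p.1.2) p₀ := hB.clm_apply h12.continuousAt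
  have hW : ContinuousAt (fun p : (E4 × E4) × (_ × _) =>
      f p.1.1 * (fderiv ℝ (fderiv ℝ f) p.1.1 p.1.2 p.1.2 - fderiv ℝ f p.1.1 ((2⁻¹ : ℝ) •
        (G₀ p.1.1 + p.2.1).inverse (koszulOp (fderiv ℝ G₀ p.1.1 + p.2.2) p.1.2 p.1.2))) -
        ρ * fderiv ℝ f p.1.1 p.1.2 ^ 2) p₀ :=
    ((hcf.comp h11.continuousAt).mul (hC.sub (hB.clm_apply ((hD.clm_apply hE).const_smul (2⁻¹ : ℝ))))).sub
      ((hβ.pow 2).const_mul ρ)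
  have hα : ContinuousAt (fun p : (E4 × E4) × (_ × _) => (G₀ p.1.1 + p.2.1) p.1.2 p.1.2) p₀ :=
    (hA.clm_apply h12.continuousAt).clm_apply h12.continuousAt
  have hγ : ContinuousAt (fun p : (E4 × E4) × (_ × _) => (G₀ p.1.1 + p.2.1) p.1.2 (V p.1.1)) p₀ :=
    (hA.clm_apply h12.continuousAt).clm_apply (hV.comp h11.continuousAt)
  by_cases h0 : G₀ x v v = 0
  · obtain ⟨hne, hslope, hconc⟩ := hxv h0
    -- the weighted concavity is strictly negative at `p₀`, hence nearby
    have hW0 : f x * (fderiv ℝ (fderiv ℝ f) x v v - fderiv ℝ f x ((2⁻¹ : ℝ) •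
        (G₀ x + 0).inverse (koszulOp (fderiv ℝ G₀ x + 0) v v))) - ρ * fderiv ℝ f x v ^ 2 < 0 := by
      rw [add_zero, add_zero]; rwa [hessAt_apply, chrAt_apply] at hconc
    have hWev := hW.eventually_lt continuousAt_const hW0
    -- the sign of `G₀ x v (V x)` decides the slope clause
    rcases hne.lt_or_gt with hlt | hgt
    · filter_upwards [hWev, hβ.eventually_lt continuousAt_const (hslope hlt)] with p hp1 hp2 _
        using ⟨fun _ => hp2, hp1⟩
    · have hgt' : 0 < (G₀ x + 0) v (V x) := by rwa [add_zero]
      filter_upwards [hWev, hγ.eventually_const_lt hgt'] with p hp1 hp2 _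
        using ⟨fun h => absurd h (not_lt.2 hp2.le), hp1⟩
  · -- the constraint fails at `p₀`, hence nearby
    have h0' : (G₀ x + 0) v v ≠ 0 := by rwa [add_zero]
    filter_upwards [hα.eventually_ne h0'] with p hp hp0 using absurd hp0 hp

/-- **`C¹`-stability of strict slope/concavity inequalities on null directions.** Let `G₀` be `C¹` and `f` be
`C²` on an open neighbourhood of the compact set `S`, `G₀ x` invertible and `V` continuous at the points of `S`,
and suppose that for every `x ∈ S` and every `G₀ x`-null `v ≠ 0`: `G₀ x v (V x) ≠ 0`, `Df_x v < 0` when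
`G₀ x v (V x) < 0`, and `f x · Hess_{G₀} f_x(v,v) − ρ (Df_x v)² < 0`. Then there is `η > 0` such that for every
`x ∈ S` and every field `G` with `‖G x − G₀ x‖ ≤ η`, `‖DG(x) − DG₀(x)‖ ≤ η`, every `G x`-null `w` has `Df_x w < 0`
when `G x w (V x) < 0`, and `f x · Hess_G f_x(w,w) ≤ ρ (Df_x w)²` (compactness of `S × sphere`, continuity of the
jet functional, homogeneity in `w`). [folklore] -/
private theorem bcs_stable {G₀ : E4 → E4 →L[ℝ] E4 →L[ℝ] ℝ} {f : E4 → ℝ} {V : E4 → E4} {U S : Set E4}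
    {ρ : ℝ} (hU : IsOpen U) (hSU : S ⊆ U) (hS : IsCompact S) (hG₀ : ContDiffOn ℝ 1 G₀ U)
    (hf : ContDiffOn ℝ 2 f U) (hi : ∀ x ∈ S, (G₀ x).IsInvertible) (hV : ∀ x ∈ S, ContinuousAt V x)
    (hbase : ∀ x ∈ S, ∀ v : E4, v ≠ 0 → G₀ x v v = 0 →
      G₀ x v (V x) ≠ 0 ∧ (G₀ x v (V x) < 0 → fderiv ℝ f x v < 0) ∧
        f x * hessAt G₀ f x v v - ρ * fderiv ℝ f x v ^ 2 < 0) :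
    ∃ η : ℝ, 0 < η ∧ ∀ x ∈ S, ∀ G : E4 → E4 →L[ℝ] E4 →L[ℝ] ℝ,
      ‖G x - G₀ x‖ ≤ η → ‖fderiv ℝ G x - fderiv ℝ G₀ x‖ ≤ η → ∀ w : E4, G x w w = 0 →
        (G x w (V x) < 0 → fderiv ℝ f x w < 0) ∧ f x * hessAt G f x w w ≤ ρ * fderiv ℝ f x w ^ 2 := by
  have hnhds : ∀ z ∈ S ×ˢ Metric.sphere (0 : E4) 1,
      ∀ᶠ p in 𝓝 ((z, 0) : (E4 × E4) × ((E4 →L[ℝ] E4 →L[ℝ] ℝ) × (E4 →L[ℝ] E4 →L[ℝ] E4 →L[ℝ] ℝ))),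
      (G₀ p.1.1 + p.2.1) p.1.2 p.1.2 = 0 →
        ((G₀ p.1.1 + p.2.1) p.1.2 (V p.1.1) < 0 → fderiv ℝ f p.1.1 p.1.2 < 0) ∧
          f p.1.1 * (fderiv ℝ (fderiv ℝ f) p.1.1 p.1.2 p.1.2 - fderiv ℝ f p.1.1 ((2⁻¹ : ℝ) •
            (G₀ p.1.1 + p.2.1).inverse (koszulOp (fderiv ℝ G₀ p.1.1 + p.2.2) p.1.2 p.1.2))) -
            ρ * fderiv ℝ f p.1.1 p.1.2 ^ 2 < 0 := by
    rintro ⟨x, v⟩ ⟨hx, hv⟩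
    have hv0 : v ≠ 0 := by rintro rfl; simp at hv
    exact bcs_eventually hU hG₀ hf (hSU hx) (hi x hx) (hV x hx) v (hbase x hx v hv0)
  obtain ⟨η, hη, hgood⟩ := bcs_tube (hS.prod (isCompact_sphere (0 : E4) 1)) hnhds
  refine ⟨η, hη, fun x hx G hG hdG w hGw => ?_⟩
  by_cases hw : w = 0
  · subst hw
    simp
  -- normalise `w` and apply the tube at the jet perturbation `(G x - G₀ x, DG(x) - DG₀(x))`
  have hn : 0 < ‖w‖ := norm_pos_iff.2 hw
  have hc : 0 < ‖w‖⁻¹ := inv_pos.2 hn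
  have hv1 : ‖‖w‖⁻¹ • w‖ = 1 := by rw [norm_smul, norm_inv, norm_norm, inv_mul_cancel₀ hn.ne']
  have key := hgood (x, ‖w‖⁻¹ • w) (mk_mem_prod hx (mem_sphere_zero_iff_norm.2 hv1))
    (G x - G₀ x, fderiv ℝ G x - fderiv ℝ G₀ x) (max_le hG hdG)
  dsimp only at key
  rw [add_sub_cancel, add_sub_cancel] at key
  have h1 : G x (‖w‖⁻¹ • w) (‖w‖⁻¹ • w) = 0 := by
    simp only [map_smul, _root_.smul_apply, hGw, smul_eq_mul, mul_zero]
  obtain ⟨hslope, hconc⟩ := key h1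
  have e2 : fderiv ℝ f x (‖w‖⁻¹ • w) = ‖w‖⁻¹ * fderiv ℝ f x w := by rw [map_smul, smul_eq_mul]
  constructor
  · intro hfut
    have hfut' : G x (‖w‖⁻¹ • w) (V x) < 0 := by
      rw [map_smul, _root_.smul_apply, smul_eq_mul]
      exact mul_neg_of_pos_of_neg hc hfut
    have h := hslope hfut'
    rw [e2] at h
    exact neg_of_mul_neg_right h hc.le
  · have hH : hessAt G f x (‖w‖⁻¹ • w) (‖w‖⁻¹ • w) = fderiv ℝ (fderiv ℝ f) x (‖w‖⁻¹ • w) (‖w‖⁻¹ • w) -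
        fderiv ℝ f x ((2⁻¹ : ℝ) • (G x).inverse (koszulOp (fderiv ℝ G x) (‖w‖⁻¹ • w) (‖w‖⁻¹ • w))) := by
      rw [hessAt_apply, chrAt_apply]
      rfl
    have e1 : hessAt G f x (‖w‖⁻¹ • w) (‖w‖⁻¹ • w) = ‖w‖⁻¹ * (‖w‖⁻¹ * hessAt G f x w w) := by
      simp only [map_smul, _root_.smul_apply, smul_eq_mul]
    rw [← hH, e1, e2] at hconc
    have hfac : f x * (‖w‖⁻¹ * (‖w‖⁻¹ * hessAt G f x w w)) - ρ * (‖w‖⁻¹ * fderiv ℝ f x w) ^ 2 =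
        ‖w‖⁻¹ ^ 2 * (f x * hessAt G f x w w - ρ * fderiv ℝ f x w ^ 2) := by ring
    rw [hfac] at hconc
    have h := neg_of_mul_neg_right hconc (pow_pos hc 2).le
    linarith

end Stability

/-! ### The boosted frame: covariance under the affine Poincaré map, and the exact certificate -/

section Boosted

variable (Λ : lorentzGroup) (c : E4) (M a : ℝ)

/-- `poincareInv Λ c` is the affine map `y ↦ −Λ⁻¹c + Λ⁻¹y`. [folklore] -/
private theorem bcs_poincareInv_eq (y : E4) :
    poincareInv Λ c y = -((Λ : E4 ≃L[ℝ] E4).symm c) + (Λ : E4 ≃L[ℝ] E4).symm y := by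
  rw [neg_add_eq_sub, ← map_sub]
  rfl

/-- The boosted Kerr–Schild form gives metric components on `{y | 0 < r(Λ⁻¹(y − c))}` (pull-back of the
Kerr–Schild components by the inverse Poincaré map, a change of coordinates). [folklore] -/
private theorem bcs_isMetricOn :
    IsMetricOn (boostedKerrBilin Λ c M a) (poincareInv Λ c ⁻¹' (Kerr.region a 0 : Set E4)) := by
  have hcc : IsCoordChangeOn (poincareInv Λ c) (poincareInv Λ c ⁻¹' (Kerr.region a 0 : Set E4))
      (Kerr.region a 0 : Set E4) :=
    { isOpen := (Kerr.region a 0).isOpen.preimage (continuous_poincareInv Λ c)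
      contDiffOn := (KerrSchildChart.contDiff_poincareInv Λ c).contDiffOn
      mapsTo := fun _ hy => hy
      isInvertible := fun y _ => ⟨(Λ : E4 ≃L[ℝ] E4).symm, (KerrSchildChart.fderiv_poincareInv Λ c y).symm⟩ }
  rw [KerrSchildChart.boostedKerrBilin_eq_pullMetric]
  exact (KerrSchildChart.isMetricOn_kerrBilin M a 0).isMetricOn_pullMetric hcc

/-- **The exact certificate read in the boosted frame** (covariance under `P = poincareInv Λ c`, `DP = Λ⁻¹`):
at a point `x` whose rest-frame radius lies in the shell, for every `v ≠ 0` null for `G₀ x = g(P x) ∘ (Λ⁻¹ × Λ⁻¹)`: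
`G₀ x v (Λ V) = g(Λ⁻¹v, V) ≠ 0` (a null vector orthogonal to the timelike `V` vanishes, O'Neill 1983, Ch. 5,
Lemma 5.26), `df_x v = d(F∘r)_{P x}(Λ⁻¹ v) < 0` when it is negative (chain rule, slope clause), and
`f x · Hess_{G₀} f_x(v,v) − ρ (df_x v)² = F(r) · Hess_g (F∘r)(Λ⁻¹v, Λ⁻¹v) − ρ (d(F∘r)(Λ⁻¹v))² < 0`
(`affineCov_hessAt`, O'Neill 1983, Ch. 3, Prop. 3.59, and the concavity clause with margin). [folklore] -/
private theorem bcs_base {M a r₁ r₂ ρ m : ℝ} {F : ℝ → ℝ} (hM : 0 ≤ M) (hm : 0 < m) (hr₁ : 0 < r₁)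
    (hcert : KerrCrushCertificate M a r₁ r₂ ρ m F) (Λ : lorentzGroup) (c : E4) {x : E4}
    (hx₁ : r₁ ≤ Kerr.radius a (poincareInv Λ c x)) (hx₂ : Kerr.radius a (poincareInv Λ c x) ≤ r₂)
    {v : E4} (hv : v ≠ 0) (hnull : boostedKerrBilin Λ c M a x v v = 0) :
    boostedKerrBilin Λ c M a x v ((Λ : E4 ≃L[ℝ] E4) (Kerr.timeVector M a (poincareInv Λ c x))) ≠ 0 ∧
      (boostedKerrBilin Λ c M a x v ((Λ : E4 ≃L[ℝ] E4) (Kerr.timeVector M a (poincareInv Λ c x))) < 0 →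
        fderiv ℝ (F ∘ Kerr.radius a ∘ poincareInv Λ c) x v < 0) ∧
      (F ∘ Kerr.radius a ∘ poincareInv Λ c) x *
          hessAt (boostedKerrBilin Λ c M a) (F ∘ Kerr.radius a ∘ poincareInv Λ c) x v v -
        ρ * fderiv ℝ (F ∘ Kerr.radius a ∘ poincareInv Λ c) x v ^ 2 < 0 := by
  have hz : 0 < Kerr.radius a (poincareInv Λ c x) := hr₁.trans_le hx₁
  have hLv : (Λ : E4 ≃L[ℝ] E4).symm v ≠ 0 := fun h => hv ((map_eq_zero_iff _ (Λ : E4 ≃L[ℝ] E4).symm.injective).1 h)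
  have hn : 0 < ‖(Λ : E4 ≃L[ℝ] E4).symm v‖ := norm_pos_iff.2 hLv
  -- the certificate at the rest-frame point `Λ⁻¹(x − c)` in the direction `Λ⁻¹ v`
  have hnull' : Kerr.bilin M a (poincareInv Λ c x) ((Λ : E4 ≃L[ℝ] E4).symm v) ((Λ : E4 ≃L[ℝ] E4).symm v) = 0 := by
    rwa [boostedKerrBilin_apply] at hnull
  obtain ⟨hslope, hconc⟩ := hcert.2.2 _ hx₁ hx₂ _ hnull'
  have e_V : boostedKerrBilin Λ c M a x v ((Λ : E4 ≃L[ℝ] E4) (Kerr.timeVector M a (poincareInv Λ c x))) =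
      Kerr.bilin M a (poincareInv Λ c x) ((Λ : E4 ≃L[ℝ] E4).symm v) (Kerr.timeVector M a (poincareInv Λ c x)) := by
    rw [boostedKerrBilin_apply, ContinuousLinearEquiv.symm_apply_apply]
  -- covariance of the slope (chain rule, `DP = Λ⁻¹`)
  have hf2 : ContDiffAt ℝ 2 (F ∘ Kerr.radius a) (poincareInv Λ c x) :=
    hcert.1.contDiffAt.comp _ (Kerr.contDiffAt_radius hz)
  have e_d : fderiv ℝ (F ∘ Kerr.radius a ∘ poincareInv Λ c) x v =
      fderiv ℝ (F ∘ Kerr.radius a) (poincareInv Λ c x) ((Λ : E4 ≃L[ℝ] E4).symm v) := by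
    show fderiv ℝ ((F ∘ Kerr.radius a) ∘ poincareInv Λ c) x v = _
    rw [fderiv_comp x (hf2.differentiableAt (by norm_num)) (KerrSchildChart.hasFDerivAt_poincareInv Λ c x).differentiableAt,
      KerrSchildChart.fderiv_poincareInv]
    rfl
  -- covariance of the Hessian (`affineCov_hessAt` for the affine map `y ↦ −Λ⁻¹c + Λ⁻¹y`)
  have e_aff : -((Λ : E4 ≃L[ℝ] E4).symm c) + (Λ : E4 ≃L[ℝ] E4).symm x = poincareInv Λ c x :=
    (bcs_poincareInv_eq Λ c x).symm
  have hreg : -((Λ : E4 ≃L[ℝ] E4).symm c) + (Λ : E4 ≃L[ℝ] E4).symm x ∈ (Kerr.region a 0 : Set E4) := by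
    rw [e_aff]
    simpa using hz
  have e_H : hessAt (boostedKerrBilin Λ c M a) (F ∘ Kerr.radius a ∘ poincareInv Λ c) x v v = hessAt (Kerr.bilin M a)
      (F ∘ Kerr.radius a) (poincareInv Λ c x) ((Λ : E4 ≃L[ℝ] E4).symm v) ((Λ : E4 ≃L[ℝ] E4).symm v) := by
    have hGfun : boostedKerrBilin Λ c M a = fun y : E4 =>
        (Kerr.bilin M a (-((Λ : E4 ≃L[ℝ] E4).symm c) + (Λ : E4 ≃L[ℝ] E4).symm y)).bilinearComp
          ((Λ : E4 ≃L[ℝ] E4).symm : E4 →L[ℝ] E4) ((Λ : E4 ≃L[ℝ] E4).symm : E4 →L[ℝ] E4) := by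
      funext y
      ext u w
      rw [boostedKerrBilin_apply, ContinuousLinearMap.bilinearComp_apply, bcs_poincareInv_eq]
      rfl
    have hffun : F ∘ Kerr.radius a ∘ poincareInv Λ c = fun y : E4 =>
        (F ∘ Kerr.radius a) (-((Λ : E4 ≃L[ℝ] E4).symm c) + (Λ : E4 ≃L[ℝ] E4).symm y) := by
      funext y
      simp only [Function.comp_apply, bcs_poincareInv_eq]
    rw [hGfun, hffun, affineCov_hessAt (Kerr.bilin M a) (F ∘ Kerr.radius a) (Λ : E4 ≃L[ℝ] E4).symm _ x
      (Kerr.region a 0 : Set E4) (KerrSchildChart.isMetricOn_kerrBilin M a 0) hreg (by rw [e_aff]; exact hf2), e_aff]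
  have e_f : (F ∘ Kerr.radius a ∘ poincareInv Λ c) x = F (Kerr.radius a (poincareInv Λ c x)) := rfl
  refine ⟨?_, fun hfut => ?_, ?_⟩
  · rw [e_V]
    intro h
    have hpos := Kerr.bilin_pos_of_orthogonal M a hz _ _ (Kerr.bilin_timeVector_timeVector_neg hM a hz)
      ((Kerr.bilin_symm M a _ _ _).trans h) hLv
    rw [hnull'] at hpos
    exact lt_irrefl _ hpos
  · rw [e_V] at hfut
    rw [e_d]
    have h := hslope hfut
    have : 0 < m * ‖(Λ : E4 ≃L[ℝ] E4).symm v‖ := mul_pos hm hn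
    linarith
  · rw [e_f, e_H, e_d]
    have : 0 < m * ‖(Λ : E4 ≃L[ℝ] E4).symm v‖ ^ 2 := mul_pos hm (pow_pos hn 2)
    linarith

end Boosted

/-! ### The registered stub -/

/-- **Stub 3b of line `null-concave-crush` (crux `SettledCapture`, stmt-FinalStateConjecture-17328) —
`C¹`-openness of the Kerr crush certificate in the boosted frame, at the level of jets.** Given the weighted
null-concave crush certificate with margin `m > 0` for exact sub-extremal Kerr `(M, a)` on the shell
`{r₋ + δ ≤ r ≤ r₊ − δ}` and a motion `mo = (Λ, c)`, there is `η > 0` such that for every field of components `G`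
and every point `y` whose rest-frame radius `r(Λ⁻¹(y − c))` lies in the shell, if the `0`-jet and the `1`-jet of
`G` at `y` are within `η` of those of `boostedKerrBilin Λ c M a`, then for every `G y`-null `w`: `df_y(w) < 0`
whenever `G y (w, Λ V(Λ⁻¹(y − c))) < 0`, and `f(y) · hessAt G f y w w ≤ ρ · (df_y w)²`, `f = F ∘ r ∘ poincareInv Λ c`.
Proof: the exact boosted certificate (`bcs_base`) is `C¹`-stable over the compact image `S` of the time slice
`{x⁰ = 0} ∩ shell` under `x ↦ Λ x + c` (`bcs_stable`), and every shell point is moved to `S` along the Killing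
orbit `y ↦ y + s Λe₀`, along which `boostedKerrBilin`, `f` and `Λ V ∘ P` are invariant, the field `G` being
translated along (`fderiv_comp_add_right`, `kerrCylindersBendInward_hessAt_comp_add_right`). [folklore] -/
theorem stub_boostedCertificateStable : ∀ (M a δ ρ m : ℝ) (F : ℝ → ℝ) (mo : lorentzGroup × E4), 0 < M → |a| < M → 0 < δ → 0 < m → KerrCrushCertificate M a (Kerr.rMinus M a + δ) (Kerr.rPlus M a - δ) ρ m F → ∃ η : ℝ, 0 < η ∧ ∀ (G : E4 → E4 →L[ℝ] E4 →L[ℝ] ℝ) (y : E4), Kerr.rMinus M a + δ ≤ Kerr.radius a (poincareInv mo.1 mo.2 y) → Kerr.radius a (poincareInv mo.1 mo.2 y) ≤ Kerr.rPlus M a - δ → ‖G y - boostedKerrBilin mo.1 mo.2 M a y‖ ≤ η → ‖fderiv ℝ G y - fderiv ℝ (boostedKerrBilin mo.1 mo.2 M a) y‖ ≤ η → ∀ w : E4, G y w w = 0 → (G y w ((mo.1 : E4 ≃L[ℝ] E4) (Kerr.timeVector M a (poincareInv mo.1 mo.2 y))) < 0 → fderiv ℝ (F ∘ Kerr.radius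 a ∘ poincareInv mo.1 mo.2) y w < 0) ∧ F (Kerr.radius a (poincareInv mo.1 mo.2 y)) * MetricCoord.hessAt G (F ∘ Kerr.radius a ∘ poincareInv mo.1 mo.2) y w w ≤ ρ * fderiv ℝ (F ∘ Kerr.radius a ∘ poincareInv mo.1 mo.2) y w ^ 2 := by
  rintro M a δ ρ m F ⟨Λ, c⟩ hM ha hδ hm hcert
  dsimp only
  have hr₁ : 0 < Kerr.rMinus M a + δ := add_pos_of_nonneg_of_pos (Kerr.IsSubextremal.rMinus_nonneg ha) hδ
  have hmet := bcs_isMetricOn Λ c M a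
  -- the compact slice `S = (x ↦ Λ x + c) '' {x⁰ = 0, r₋ + δ ≤ r ≤ r₊ − δ}`
  set S : Set E4 := (fun z : E4 => (Λ : E4 ≃L[ℝ] E4) z + c) ''
    {z : E4 | z 0 = 0 ∧ Kerr.rMinus M a + δ ≤ Kerr.radius a z ∧ Kerr.radius a z ≤ Kerr.rPlus M a - δ} with hSdef
  have hS : IsCompact S :=
    (kerrCylindersBendInward_isCompact_slice a _ hr₁).image ((Λ : E4 ≃L[ℝ] E4).continuous.add continuous_const)
  have hPz : ∀ z : E4, poincareInv Λ c ((Λ : E4 ≃L[ℝ] E4) z + c) = z := fun z => by simp [poincareInv]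
  have hSsh : ∀ x ∈ S, Kerr.rMinus M a + δ ≤ Kerr.radius a (poincareInv Λ c x) ∧
      Kerr.radius a (poincareInv Λ c x) ≤ Kerr.rPlus M a - δ := by
    rintro _ ⟨z, hz, rfl⟩
    rw [hPz]
    exact hz.2
  have hSpos : ∀ x ∈ S, 0 < Kerr.radius a (poincareInv Λ c x) := fun x hx => hr₁.trans_le (hSsh x hx).1
  have hSU : S ⊆ poincareInv Λ c ⁻¹' (Kerr.region a 0 : Set E4) := fun x hx => by simpa using hSpos x hx
  -- regularity of `G₀`, `f` and `Λ V ∘ P`, and the stability statement on the slice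
  have hG₀ : ContDiffOn ℝ 1 (boostedKerrBilin Λ c M a) (poincareInv Λ c ⁻¹' (Kerr.region a 0 : Set E4)) :=
    hmet.contDiffOn.of_le (by exact_mod_cast le_top)
  have hf : ContDiffOn ℝ 2 (F ∘ Kerr.radius a ∘ poincareInv Λ c) (poincareInv Λ c ⁻¹' (Kerr.region a 0 : Set E4)) :=
    fun y hy => (hcert.1.contDiffAt.comp y ((Kerr.contDiffAt_radius (Kerr.radius_pos_of_mem_region hy)).comp y
      (KerrSchildChart.contDiff_poincareInv Λ c).contDiffAt)).contDiffWithinAt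
  have hV : ∀ x ∈ S, ContinuousAt (fun y : E4 => (Λ : E4 ≃L[ℝ] E4) (Kerr.timeVector M a (poincareInv Λ c y))) x :=
    fun x hx => (Λ : E4 ≃L[ℝ] E4).continuous.continuousAt.comp
      ((Kerr.contDiffAt_timeVector M a (hSpos x hx) (n := 0)).continuousAt.comp (continuous_poincareInv Λ c).continuousAt)
  obtain ⟨η, hη, hgood⟩ := bcs_stable (ρ := ρ) hmet.isOpen hSU hS hG₀ hf (fun x hx => hmet.isInvertible x (hSU hx))
    hV (fun x hx v hv hnull => bcs_base hM.le hm hr₁ hcert Λ c (hSsh x hx).1 (hSsh x hx).2 hv hnull)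
  refine ⟨η, hη, fun G y hy₁ hy₂ hG hdG w hGw => ?_⟩
  -- translate `y` to the slice along the Killing orbit: `y = y' + t Λe₀`
  obtain ⟨t, ht⟩ : ∃ t : ℝ, poincareInv Λ c y 0 = t := ⟨_, rfl⟩
  obtain ⟨y', hyy'⟩ : ∃ y' : E4, y' + t • (Λ : E4 ≃L[ℝ] E4) (EuclideanSpace.single (0 : Fin 4) (1 : ℝ)) = y :=
    ⟨y - t • (Λ : E4 ≃L[ℝ] E4) (EuclideanSpace.single (0 : Fin 4) (1 : ℝ)), sub_add_cancel y _⟩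
  have hPy' : poincareInv Λ c y' = poincareInv Λ c y + (-t) • E4.basisVector 0 := by
    rw [← hyy', KerrSchildChart.poincareInv_add_smul, add_assoc, ← add_smul, add_neg_cancel, zero_smul, add_zero]
  have hy'S : y' ∈ S := by
    refine ⟨poincareInv Λ c y', ⟨?_, ?_, ?_⟩, ?_⟩
    · rw [hPy']; simp [E4.basisVector, ht]
    · rw [hPy', Kerr.radius_add_time_smul_basisVector]; exact hy₁
    · rw [hPy', Kerr.radius_add_time_smul_basisVector]; exact hy₂
    · simp [poincareInv]
  -- stationarity: the jets at `y'` are those at `y`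
  have hfinv : ∀ z : E4, (F ∘ Kerr.radius a ∘ poincareInv Λ c)
      (z + t • (Λ : E4 ≃L[ℝ] E4) (EuclideanSpace.single (0 : Fin 4) (1 : ℝ))) = (F ∘ Kerr.radius a ∘ poincareInv Λ c) z :=
    fun z => by
      simp only [Function.comp_apply, KerrSchildChart.poincareInv_add_smul, Kerr.radius_add_time_smul_basisVector]
  have e_g : boostedKerrBilin Λ c M a y' = boostedKerrBilin Λ c M a y := by
    rw [← hyy', KerrSchildChart.boostedKerrBilin_add_smul]
  have e_dg : fderiv ℝ (boostedKerrBilin Λ c M a) y' = fderiv ℝ (boostedKerrBilin Λ c M a) y := by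
    rw [← hyy', KerrSchildChart.fderiv_eq_of_forall_add_eq (fun z => KerrSchildChart.boostedKerrBilin_add_smul Λ c M a z t)]
  have e_f : (F ∘ Kerr.radius a ∘ poincareInv Λ c) y' = (F ∘ Kerr.radius a ∘ poincareInv Λ c) y := by
    rw [← hyy', hfinv]
  have e_df : fderiv ℝ (F ∘ Kerr.radius a ∘ poincareInv Λ c) y' = fderiv ℝ (F ∘ Kerr.radius a ∘ poincareInv Λ c) y := by
    rw [← hyy', KerrSchildChart.fderiv_eq_of_forall_add_eq hfinv]
  have e_V : (Λ : E4 ≃L[ℝ] E4) (Kerr.timeVector M a (poincareInv Λ c y')) =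
      (Λ : E4 ≃L[ℝ] E4) (Kerr.timeVector M a (poincareInv Λ c y)) := by
    rw [← hyy', KerrSchildChart.poincareInv_add_smul, Kerr.timeVector_add_smul_basisVector_zero]
  have e_G : fderiv ℝ (fun z : E4 => G (z + t • (Λ : E4 ≃L[ℝ] E4) (EuclideanSpace.single (0 : Fin 4) (1 : ℝ)))) y' =
      fderiv ℝ G y := by
    rw [fderiv_comp_add_right, hyy']
  have e_H : hessAt (fun z : E4 => G (z + t • (Λ : E4 ≃L[ℝ] E4) (EuclideanSpace.single (0 : Fin 4) (1 : ℝ))))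
      (F ∘ Kerr.radius a ∘ poincareInv Λ c) y' = hessAt G (F ∘ Kerr.radius a ∘ poincareInv Λ c) y := by
    have h := kerrCylindersBendInward_hessAt_comp_add_right G (F ∘ Kerr.radius a ∘ poincareInv Λ c)
      (t • (Λ : E4 ≃L[ℝ] E4) (EuclideanSpace.single (0 : Fin 4) (1 : ℝ))) y'
    rw [show (fun z : E4 => (F ∘ Kerr.radius a ∘ poincareInv Λ c)
        (z + t • (Λ : E4 ≃L[ℝ] E4) (EuclideanSpace.single (0 : Fin 4) (1 : ℝ)))) = F ∘ Kerr.radius a ∘ poincareInv Λ c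
        from funext hfinv, hyy'] at h
    exact h
  -- the slice statement for the translated field `G ∘ (· + t Λe₀)` at `y'`
  have key := hgood y' hy'S (fun z : E4 => G (z + t • (Λ : E4 ≃L[ℝ] E4) (EuclideanSpace.single (0 : Fin 4) (1 : ℝ))))
    (by rw [hyy', e_g]; exact hG) (by rw [e_G, e_dg]; exact hdG) w (by rw [hyy']; exact hGw)
  rw [hyy', e_V, e_f, e_df, e_H] at key
  exact key

end Summit.FinalStateConjecture.FinalStateConjecture.Theorems.BartnikGapSettling.SettledCapture

end
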